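import Mathlib
import Summits.Ventures.PercRepro2.LocRows
import Summits.Ventures.PercRepro2.SwRow
import Summits.Ventures.PercRepro2.SwOut
import Summits.Ventures.PercRepro2.SwAllRow
import Summits.Ventures.PercRepro2.SwOutAll
import Summits.Ventures.PercRepro2.SwOutSeriesDefs

/-!
# Parking a loop inside an outside class (blind cell PercRepro2, night-4 g10, 2026-08-25;
proofs/NIGHT4-G10.md §2, Remark (ii′))

A LOOP `e₁` at a vertex `p ∈ U` is free in the class and never matters for the clusters; PARKING it
at `l ∉ U` (`parkLoop`: `e₁` becomes a loop at `l`, hence pinned) is again an operation on the same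
edge type.  The class of `(G, U, ξ)` is the class of `(G', U, ξ[e₁ ↦ false])` with the colour of `e₁`
free; the red edge set of `h` gains `e₁` exactly when `e₁` is red and `p ∈ C_R(h)` (the tag
`tagSub`).  THEOREM P (`card_le_of_loop`): the rigid counting inequalities of the parked class, for
every up-set, give those of the class — the loop step of the induction of the cycle theorem (the
contraction of a 2-cycle leaves a loop).
-/

namespace Summit.Ventures.PercRepro2

namespace LocRows

open Hull

variable {V : Type*} {E : Type*} [Fintype E] [DecidableEq E]

open scoped Classical

/-- The parked graph: the loop `e₁` moved to `l`. -/
noncomputable def parkLoop (ends : E → Sym2 V) (l : V) (e₁ : E) : E → Sym2 V :=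
  Function.update ends e₁ s(l, l)

variable {ends : E → Sym2 V} {l p : V} {e₁ : E}

omit [Fintype E] in
/-- `e₁` is a loop at `l` in the parked graph. -/
lemma parkLoop_apply_e₁ : parkLoop ends l e₁ e₁ = s(l, l) := by simp [parkLoop]

omit [Fintype E] in
/-- The other edges are unchanged. -/
lemma parkLoop_apply_of_ne {e : E} (h₁ : e ≠ e₁) : parkLoop ends l e₁ e = ends e := by
  simp [parkLoop, Function.update_of_ne h₁]

section Loop

variable (hs : ends e₁ = s(p, p))
include hs

omit [Fintype E] in
/-- A loop gives no adjacency: the open graphs of `G` and of the parked graph agree. -/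
lemma openGraph_parkLoop (ω : Config E) : openGraph (parkLoop ends l e₁) ω = openGraph ends ω := by
  ext x y
  rw [openGraph_adj, openGraph_adj]
  constructor
  · rintro ⟨hxy, e, he, hends⟩
    have he₁ : e ≠ e₁ := by
      rintro rfl
      rw [parkLoop_apply_e₁, Sym2.eq_iff] at hends
      exact hxy (by rcases hends with ⟨h, h'⟩ | ⟨h, h'⟩ <;>
        first | exact h.symm.trans h' | exact h'.symm.trans h)
    exact ⟨hxy, e, he, by rw [parkLoop_apply_of_ne he₁] at hends; exact hends⟩
  · rintro ⟨hxy, e, he, hends⟩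
    have he₁ : e ≠ e₁ := by
      rintro rfl
      rw [hs, Sym2.eq_iff] at hends
      exact hxy (by rcases hends with ⟨h, h'⟩ | ⟨h, h'⟩ <;>
        first | exact h.symm.trans h' | exact h'.symm.trans h)
    exact ⟨hxy, e, he, by rw [parkLoop_apply_of_ne he₁]; exact hends⟩

omit [Fintype E] in
/-- Clusters agree (for any colouring). -/
lemma cluster_parkLoop (ω : Config E) (x : V) :
    cluster (parkLoop ends l e₁) ω x = cluster ends ω x := by
  ext v
  simp only [mem_cluster, Conn, openGraph_parkLoop hs]

omit [Fintype E] in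
/-- Clusters of the parked graph with the loop recoloured. -/
lemma cluster_parkLoop_update (ω : Config E) (b : Bool) (x : V) :
    cluster (parkLoop ends l e₁) (Function.update ω e₁ b) x = cluster ends ω x := by
  rw [cluster_update_of_loop (parkLoop_apply_e₁ (ends := ends) (l := l) (e₁ := e₁))]
  exact cluster_parkLoop hs ω x

omit [Fintype E] hs in
/-- The edges touching `U` in the parked graph are those touching `U` other than `e₁` (`l ∉ U`). -/
lemma mem_touches_parkLoop_iff {U : Set V} (hl : l ∉ U) {e : E} :
    e ∈ touches (parkLoop ends l e₁) U ↔ e ∈ touches ends U ∧ e ≠ e₁ := by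
  by_cases he₁ : e = e₁
  · subst e
    simp only [ne_eq, not_true_eq_false, and_false, iff_false]
    rintro ⟨x, hx, y, hxy⟩
    rw [parkLoop_apply_e₁, Sym2.eq_iff] at hxy
    rcases hxy with ⟨rfl, _⟩ | ⟨_, rfl⟩ <;> exact hl hx
  · simp only [ne_eq, he₁, not_false_eq_true, and_true]
    constructor
    · rintro ⟨x, hx, y, hxy⟩
      rw [parkLoop_apply_of_ne he₁] at hxy
      exact ⟨x, hx, y, hxy⟩
    · rintro ⟨x, hx, y, hxy⟩
      exact ⟨x, hx, y, by rw [parkLoop_apply_of_ne he₁]; exact hxy⟩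

/-- **The class correspondence of the parking**: a configuration lies in the outside class of
`(G, U, ξ)` iff its canonical image (the loop recoloured `false`) lies in the outside class of
`(G', U, ξ[e₁ ↦ false])`. -/
theorem mem_swOutSide_parkLoop_iff {U : Set V} {ξ : Config E} {h o : V} (hl : l ∉ U) (hp : p ∈ U)
    {ζ : Config E} :
    ζ ∈ swOutSide ends l h o U ξ ↔
      Function.update ζ e₁ false ∈
        swOutSide (parkLoop ends l e₁) l h o U (Function.update ξ e₁ false) := by
  have hblue : blue (Function.update ζ e₁ false) = Function.update (blue ζ) e₁ true := by
    rw [blue_update]; rfl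
  have hA : ∀ x, cluster (parkLoop ends l e₁) (Function.update ζ e₁ false) x = cluster ends ζ x :=
    fun x => cluster_parkLoop_update hs ζ false x
  have hB : ∀ x, cluster (parkLoop ends l e₁) (blue (Function.update ζ e₁ false)) x =
      cluster ends (blue ζ) x := by
    intro x; rw [hblue]; exact cluster_parkLoop_update hs (blue ζ) true x
  have he₁U : e₁ ∈ touches ends U := ⟨p, hp, p, hs⟩
  rw [mem_swOutSide, mem_swOutSide, mem_outClass, mem_outClass]
  simp only [tgtU, Finset.mem_filter, Finset.mem_univ, true_and, Set.mem_setOf_eq, hull, hA, hB]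
  constructor
  · rintro ⟨hQ, hpin, hhull⟩
    refine ⟨hQ, ?_, hhull⟩
    intro e he
    rw [mem_touches_parkLoop_iff hl] at he
    by_cases he₁ : e = e₁
    · subst e; simp
    · have heU : e ∉ touches ends U := fun h' => he ⟨h', he₁⟩
      rw [Function.update_of_ne he₁, Function.update_of_ne he₁]
      exact hpin e heU
  · rintro ⟨hQ, hpin, hhull⟩
    refine ⟨hQ, ?_, hhull⟩
    intro e he
    have he₁ : e ≠ e₁ := by rintro rfl; exact he he₁U
    have he' : e ∉ touches (parkLoop ends l e₁) U := by
      rw [mem_touches_parkLoop_iff hl]; exact fun h' => he h'.1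
    have := hpin e he'
    rwa [Function.update_of_ne he₁, Function.update_of_ne he₁] at this

end Loop

end LocRows

end Summit.Ventures.PercRepro2
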